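import Summits.Ventures.HSemireg.WedgeHankelRecurrenceTraceForm
import Summits.Ventures.HSemireg.WedgeHankelRecurrenceSplitting
import Summits.Ventures.HSemireg.WedgeHankelRecurrenceSylvester

/-!
# Venture HSemireg — TRACES OF THE MULTIPLICATION MATRICES OF `K[X]/(m)` AS SUMS OVER THE ROOTS: for `m` monic of degree `t + 1` and a field embedding `φ` under which `m` splits,
# **`φ (trace M_a) = Σ_{λ ∈ roots(φ m)} (φ a)(λ)`** and **`φ (trace (M_X ^ j)) = Σ_{λ ∈ roots(φ m)} λ^j`** (roots with multiplicity) — N103's Euler–Tate trace formula `trace M_a = dualSeq m (a m′) 0`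
# composed with N107's base change of the symbol and N108's weighted partial fractions; the matrix `M_X = mulResidueMat m X` is the companion matrix of `m` (N82 `charpoly_mulResidueMat_X`), so this is
# «`trace (C_m ^ j) = j`-th power sum of the roots of `m`» for every `j`, which Mathlib states for `j = 1` only (`Matrix.trace_eq_sum_roots_charpoly_of_splits`)

HONEST FRAMING. Part of the Lean index of the computation cell `pub-hsemireg` (seat p10 gen 31, Sunday typer «UNIFORM-IN-n»).
LINEAR ALGEBRA OF HANKEL (catalecticant) MATRICES and of polynomials over a field ONLY (`Matrix.trace`, `Polynomial.roots`, `Polynomial.Splits`, `SplittingField`): no variety, no cohomology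
theory, no sheaf, no Ext group and no semiregularity map is constructed here; nothing here says that HC / HC_CM / HC_AV holds; no Literature fact is declared or used.
Custodian versions as in `WedgeHankelSiegelIdeal` (1/3).

WHAT IS IN THE TREE ∕ PARENTS.  N103 (`TraceForm`): `trace_mulResidueMat`, `trace_mulResidueMat_X_pow`.  N107 (`Splitting`): `dualSeq_map`, `map_dualSeq_derivative_eq_sum_roots_pow`.  N108 (`Sylvester`):
`dualSeq_multiset_prod_X_sub_C_mul_derivative`.  Mathlib: `Polynomial.Splits.eq_prod_roots_of_monic`, `derivative_map`, `SplittingField.splits`, `IsAlgClosed.splits`.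
THIS FILE (namespace `Summit.Ventures.HSemireg.Wedge.HankelOuter` continued; CHAINED on N103 + N107 + N108 (all three PLAIN); 0 definitions):
* §665 **`map_dualSeq_mul_derivative_eq_sum_roots`** (`φ (dualSeq m (a m′) j) = Σ_λ (φ a)(λ) λ^j`), **`map_trace_mulResidueMat_eq_sum_roots`** (`φ (trace M_a) = Σ_λ (φ a)(λ)`),
  **`map_trace_mulResidueMat_X_pow_eq_sum_roots_pow`** (`φ (trace (M_X^j)) = Σ_λ λ^j`), `trace_mulResidueMat_X_pow_eq_sum_roots_pow` (`m` split over `K`), `trace_mulResidueMat_X_pow_eq_sum_roots_pow_of_isAlgClosed`.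
Nothing Ext-side.  New names only.
-/

open Module Polynomial
open scoped Matrix Polynomial

namespace Summit.Ventures.HSemireg.Wedge.HankelOuter

open Summit.Ventures.HSemireg.Wedge Summit.Ventures.HSemireg.Wedge.Hankel

variable (K : Type*) [Field K]

/-! ## §665. Traces as sums over the roots -/

/-- **`φ (dualSeq m (a·m′) j) = Σ_{λ ∈ roots(φ m)} (φ a)(λ) · λ^j`** for `m` monic and a field embedding `φ` under which `m` splits (N107's base change + N108's weighted partial fractions). -/
theorem map_dualSeq_mul_derivative_eq_sum_roots {L : Type*} [Field L] (φ : K →+* L) {m : K[X]} (hm : m.Monic) (hs : (m.map φ).Splits) (a : K[X]) (j : ℕ) :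
    φ (dualSeq K m (a * derivative m) j) = ((m.map φ).roots.map fun c => (a.map φ).eval c * c ^ j).sum := by
  have h1 := congrFun (dualSeq_map K φ hm (a * derivative m)) j
  rw [Polynomial.map_mul, ← Polynomial.derivative_map] at h1
  rw [← h1]
  have hP := hs.eq_prod_roots_of_monic (hm.map φ)
  have h2 := congrFun (dualSeq_multiset_prod_X_sub_C_mul_derivative L (m.map φ).roots (a.map φ)) j
  rw [← hP] at h2
  exact h2

/-- **The trace of multiplication by `a` on `K[X]/(m)` is `Σ_λ a(λ)` over the roots (with multiplicity) in any field where `m` splits: `φ (trace M_a) = Σ_{λ ∈ roots(φ m)} (φ a)(λ)`**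
(`m` monic of degree `t + 1`; N103 `trace M_a = dualSeq m (a m′) 0` + the previous theorem at `j = 0`). -/
theorem map_trace_mulResidueMat_eq_sum_roots {L : Type*} [Field L] (φ : K →+* L) {t : ℕ} {m : K[X]} (hm : m.Monic) (hmd : m.natDegree = t + 1) (hs : (m.map φ).Splits) (a : K[X]) :
    φ (mulResidueMat K t m a).trace = ((m.map φ).roots.map fun c => (a.map φ).eval c).sum := by
  rw [trace_mulResidueMat K hm hmd, map_dualSeq_mul_derivative_eq_sum_roots K φ hm hs a 0]
  simp only [pow_zero, mul_one]

/-- **`φ (trace (M_X ^ j)) = Σ_{λ ∈ roots(φ m)} λ^j`: the traces of the powers of the companion ∕ shift matrix of `m` are the power sums of the roots of `m`, in any field where `m` splits**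
(`m` monic of degree `t + 1`, every `j`; N103 `trace (M_X^j) = dualSeq m m′ j` + N107). -/
theorem map_trace_mulResidueMat_X_pow_eq_sum_roots_pow {L : Type*} [Field L] (φ : K →+* L) {t : ℕ} {m : K[X]} (hm : m.Monic) (hmd : m.natDegree = t + 1) (hs : (m.map φ).Splits) (j : ℕ) :
    φ ((mulResidueMat K t m Polynomial.X) ^ j).trace = ((m.map φ).roots.map fun c => c ^ j).sum := by
  rw [trace_mulResidueMat_X_pow K hm hmd, map_dualSeq_derivative_eq_sum_roots_pow K φ hm hs]

/-- The split case over `K` itself: `trace (M_X ^ j) = Σ_{λ ∈ m.roots} λ^j`. -/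
theorem trace_mulResidueMat_X_pow_eq_sum_roots_pow {t : ℕ} {m : K[X]} (hm : m.Monic) (hmd : m.natDegree = t + 1) (hs : m.Splits) (j : ℕ) :
    ((mulResidueMat K t m Polynomial.X) ^ j).trace = (m.roots.map fun c => c ^ j).sum := by
  rw [trace_mulResidueMat_X_pow K hm hmd, dualSeq_derivative_eq_sum_roots_pow K hm hs]

/-- Over an algebraically closed field every `m` splits: `trace (M_X ^ j) = Σ_{λ ∈ m.roots} λ^j` (`m` monic of degree `t + 1`). -/
theorem trace_mulResidueMat_X_pow_eq_sum_roots_pow_of_isAlgClosed [IsAlgClosed K] {t : ℕ} {m : K[X]} (hm : m.Monic) (hmd : m.natDegree = t + 1) (j : ℕ) :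
    ((mulResidueMat K t m Polynomial.X) ^ j).trace = (m.roots.map fun c => c ^ j).sum :=
  trace_mulResidueMat_X_pow_eq_sum_roots_pow K hm hmd (IsAlgClosed.splits m) j

/-- In the splitting field: `algebraMap K m.SplittingField (trace (M_X ^ j)) = Σ_{λ ∈ roots} λ^j`. -/
theorem algebraMap_trace_mulResidueMat_X_pow_eq_sum_roots_pow {t : ℕ} {m : K[X]} (hm : m.Monic) (hmd : m.natDegree = t + 1) (j : ℕ) :
    algebraMap K m.SplittingField ((mulResidueMat K t m Polynomial.X) ^ j).trace = ((m.map (algebraMap K m.SplittingField)).roots.map fun c => c ^ j).sum :=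
  map_trace_mulResidueMat_X_pow_eq_sum_roots_pow K (algebraMap K m.SplittingField) hm hmd (SplittingField.splits m) j

end Summit.Ventures.HSemireg.Wedge.HankelOuter
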